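import Literature.MathematicalPhysics.QuantumFieldTheory.Balaban1983to89.B15Prop1LocalChartAtBaseField

/-!
# `Balaban1983to89.B15Prop1MinimiserFamilyAtRecord` — [Balaban1989LargeFieldI] = «[IV]», (1.74) p. 192, Prop. 1 p. 194 (last clause); [Balaban1985Variational] = «[15]», Thm 1 p. 279,
# Sect. G pp. 305–309, Prop. 9 (190) p. 309; [Balaban1988Convergent] = «[III]», (2.11)–(2.14) pp. 256–257:
# THE LETTER (J0′) `hMin` OF THE N12 ENDPOINTS FROM PRINT-SHAPED PER-BASE-FIELD LETTERS — the w1-lineage reduction assembled: local charts at every base field of a compact set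
# (`B15Prop1LocalChartAtBaseField`) + one radius by compactness (`B15Prop1MinimiserFamilyPatching`)

Honest framing: statement-level skeleton of published theorems with citation tags; proofs where landed; nothing here is a claim about the
Yang–Mills mass gap.  Cell `pub-ymgap`, HUMAN RULING D-0149 (width seats), seat `pub-ymgap-dag-n12-w1` (g2; N12 = [B15]; U1a⁺ of the w1 lineage, U1A-CENSUS §4 item 1 (δ′));
count-neutral; N12 NOT discharged; finite 𝕋⁴ at fixed ε; nothing continuum ∕ OS ∕ mass-gap ∕ Clay.

WHAT.  For the chart family `Q_k^{s*}(exp(iB′)·ext(exp(ip)V_k))` of [IV] Prop. 1 (`ext = extend Λ (shellGauge · lo hi)`), the exp-mean-log averaging of record, a class `reg`, a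
determining set `𝔹` of levels `≤ k`, and a compact set `K` of base fields `V_k`: IF at every `V_k ∈ K` one has — a configuration `U₀(V_k)` on the fibre of the base datum
`Q₀(V_k) = Q_k^{s*}(ext V_k)` (print: THE minimiser, [15] Thm 1 existence), both guarded below `k`; a conjugation-stable gauge slice `S(V_k)`; and, in the slice coordinates of this
lineage (`B15Prop1LocalChartAtBaseField`), the print-shaped letters `hcrit` (Lagrange criticality of `U₀`), `honto` ([15] (45)∕(47)), `hnondeg` ((β), [LF-II] (1.9)), `hclass` (the class is
open at `U₀`), `hcritT` (criticality transfer, [15] Sect. F), and `hT1u` ([15] Thm 1 «unique critical orbit in (6)») — THEN there is ONE radius `R > 0` such that for EVERY `V_k ∈ K` the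
three clauses of the intrinsic analytic letter (J0′) `hMin` of `B15Prop1JointHolomorphyFromMinimiserFamily[OneSided]` hold on the complex sup-ball `ball 0 R`.

CONTENTS (theorems only; no `def`, no `instance`, no `sorry`).  ★★★ `hMin_of_baseFieldLetters`.
-/

noncomputable section

namespace Literature.MathematicalPhysics.QuantumFieldTheory.Balaban1983to89.B15Prop1MinimiserFamilyAtRecord

open Set Metric Filter
open scoped Topology ContDiff ComplexConjugate
open Literature.MathematicalPhysics.QuantumFieldTheory.Balaban1983to89.Node00 (SU coeField coeField_apply SmallBelow ConstrSet constrCard constrEnum)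
open B15AveragingHolomorphic (iterMh)
open B15ComplexifiedDatumFamily (conjVec datumC datumC_real)
open B15SU2ChartHolomorphic (expMulC logCoordC)
open B15Prop1MinimiserFamilyPatching (hMin_of_localCharts)
open B15Prop1CriticalChartFromIFT (datumC_coeField_zero)
open B15Prop1LocalChartAtBaseField (exists_localChart_at_baseField)
open Literature.MathematicalPhysics.QuantumFieldTheory.BalabanImbrieJaffe1984to88.BIJ85Eq453GaugeField (qsstarGIter0)
open B15Prop1AnalyticExtClause (cplxVec)
open B15Prop1ChartCalculusSU2 (E3)
open B15Prop1ChartSU2 (su2Chart)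
open B15ShellGauge193 (shellGauge)
open B15Extension193 (extend)
open B16Sect1Backgrounds (expMul)
open ExpMeanLog (expMeanLogSU)
open BlockAveraging (blockAvg)
open T4CubeChartGnomonic (SU2)
open T4Continuum B15DeterminingSets GaugeField
open scoped Matrix.Norms.L2Operator

variable {P : Params} {k : ℕ}

/-- ★★★ **THE LETTER (J0′) `hMin` FROM PRINT-SHAPED PER-BASE-FIELD LETTERS** (see the module docstring).  Per base field `V_k ∈ K` the hypothesis `hbase` packages: the base
configuration `U₀` on the fibre of the base datum, the two guards, the gauge slice `S` with its conjugation-stability, the action `a` and constraint coordinates `Φ₀` on the slice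
(characterised pointwise, as in `B15Prop1LocalChartAtBaseField.exists_localChart_at_baseField`), and the DISPLAYED letters `hcrit`, `honto`, `hnondeg`, `hclass`, `hcritT`; `hT1u` is [15]
Thm 1's clause near each base datum.  Conclusion: ONE `R > 0` and, for every `V_k ∈ K`, the three clauses of `hMin`. [cite: Balaban1985Variational, Thm 1 p.279, Sect. G pp.305–307, Prop. 9 (190) p.309; Balaban1989LargeFieldI, (1.74) p.192, Prop. 1 p.194 (last clause); Balaban1988Convergent, (2.11)–(2.14) pp.256–257; LuenbergerYe2008, §10.7 pp.306–307] -/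
theorem hMin_of_baseFieldLetters (Λ : Set (Site P k)) (lo hi : Fin P.d → ℤ)
    (reg : Set (GaugeField P 0 SU2)) (𝔹 : DetSet P) (h𝔹 : ∀ j, k < j → 𝔹 j = ∅)
    (ext : GaugeField P k SU2 → GaugeField P k SU2) (hext : ∀ W, ext W = extend Λ (shellGauge W lo hi) W)
    {K : Set (GaugeField P k SU2)} (hK : IsCompact K) {𝓐₀ : ℝ} (h𝓐₀ : 1 < 𝓐₀)
    (Crit : GaugeField P 0 SU2 → GaugeField P 0 SU2 → Prop)
    -- per base field: the base configuration, the guards, the slice, the coordinates, and the displayed letters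
    (hbase : ∀ Vk ∈ K, ∃ (U₀ : GaugeField P 0 SU2) (S : Submodule ℂ (VecField P 0 (EuclideanSpace ℂ (Fin 3))))
        (a : S → ℂ) (Φ₀ : S → Fin (constrCard 𝔹 k) → EuclideanSpace ℂ (Fin 3)) (ℓ₀ : (Fin (constrCard 𝔹 k) → EuclideanSpace ℂ (Fin 3)) →L[ℂ] ℂ),
      SmallBelow (fun j => blockAvg (P := P) (j := j) expMeanLogSU) k (qsstarGIter0 k (ext Vk)) ∧
      SmallBelow (fun j => blockAvg (P := P) (j := j) expMeanLogSU) k U₀ ∧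
      AgreeOn 𝔹 (avgFamily (fun j => blockAvg (P := P) (j := j) expMeanLogSU) U₀)
        (avgFamily (fun j => blockAvg (P := P) (j := j) expMeanLogSU) (qsstarGIter0 k (ext Vk))) ∧
      (∀ X ∈ S, conjVec X ∈ S) ∧
      (∀ X : S, a X = ∑ p : Plaq P 0, (1 - (expMulC (X : VecField P 0 (EuclideanSpace ℂ (Fin 3))) (coeField U₀) ⟨p.src, p.μ⟩ *
        expMulC (X : VecField P 0 (EuclideanSpace ℂ (Fin 3))) (coeField U₀) ⟨p.src.shift p.μ, p.ν⟩ *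
        Matrix.adjugate (expMulC (X : VecField P 0 (EuclideanSpace ℂ (Fin 3))) (coeField U₀) ⟨p.src.shift p.ν, p.μ⟩) *
        Matrix.adjugate (expMulC (X : VecField P 0 (EuclideanSpace ℂ (Fin 3))) (coeField U₀) ⟨p.src, p.ν⟩)).trace / 2)) ∧
      (∀ (X : S) i, Φ₀ X i = logCoordC (star ((avgFamily (fun j => blockAvg (P := P) (j := j) expMeanLogSU) (qsstarGIter0 k (ext Vk))
        ((constrEnum 𝔹 k).symm i).1 ((constrEnum 𝔹 k).symm i).2.1 : SU2) : Matrix (Fin 2) (Fin 2) ℂ) *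
        iterMh ((constrEnum 𝔹 k).symm i).1 (expMulC (X : VecField P 0 (EuclideanSpace ℂ (Fin 3))) (coeField U₀)) ((constrEnum 𝔹 k).symm i).2.1)) ∧
      -- DISPLAYED
      fderiv ℂ a 0 = ℓ₀.comp (fderiv ℂ Φ₀ 0) ∧
      Function.Surjective (fderiv ℂ Φ₀ 0) ∧
      (∀ s : S, fderiv ℂ Φ₀ 0 s = 0 →
        (∀ t : S, fderiv ℂ Φ₀ 0 t = 0 → fderiv ℂ (fderiv ℂ a) 0 s t - ℓ₀ (fderiv ℂ (fderiv ℂ Φ₀) 0 s t) = 0) → s = 0) ∧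
      (∀ᶠ Q in 𝓝 (coeField U₀), ∀ U' : GaugeField P 0 SU2, coeField U' = Q → U' ∈ reg) ∧
      (∀ᶠ w in 𝓝 ((0 : S), coeField (qsstarGIter0 k (ext Vk))), ∀ (U' Q' : GaugeField P 0 SU2) (μ : (Fin (constrCard 𝔹 k) → EuclideanSpace ℂ (Fin 3)) →L[ℂ] ℂ),
        expMulC (w.1 : VecField P 0 (EuclideanSpace ℂ (Fin 3))) (coeField U₀) = coeField U' → coeField Q' = w.2 →
          AgreeOn 𝔹 (avgFamily (fun j => blockAvg (P := P) (j := j) expMeanLogSU) U') (avgFamily (fun j => blockAvg (P := P) (j := j) expMeanLogSU) Q') →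
          fderiv ℂ a w.1 = μ.comp (fderiv ℂ Φ₀ w.1) → Crit Q' U'))
    -- [15] Thm 1's uniqueness clause near each base datum (DISPLAYED)
    (hT1u : ∀ Vk ∈ K, ∀ᶠ Q in 𝓝 (coeField (qsstarGIter0 k (ext Vk))), ∀ U' Q' : GaugeField P 0 SU2, coeField Q' = Q →
      U' ∈ reg → AgreeOn 𝔹 (avgFamily (fun j => blockAvg (P := P) (j := j) expMeanLogSU) U') (avgFamily (fun j => blockAvg (P := P) (j := j) expMeanLogSU) Q') →
        Crit Q' U' → IsMinimizer (fun j => blockAvg (P := P) (j := j) expMeanLogSU) reg 𝔹 (avgFamily (fun j => blockAvg (P := P) (j := j) expMeanLogSU) Q') U') :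
    ∃ R : ℝ, 0 < R ∧ ∀ Vk ∈ K,
      ∃ Ũ : VecField P k (EuclideanSpace ℂ (Fin 3)) × VecField P k (EuclideanSpace ℂ (Fin 3)) → PBond P 0 → Matrix (Fin 2) (Fin 2) ℂ,
        (∀ b i j, DifferentiableOn ℂ (fun z => Ũ z b i j) (ball 0 R)) ∧
        (∀ z ∈ ball (0 : VecField P k (EuclideanSpace ℂ (Fin 3)) × VecField P k (EuclideanSpace ℂ (Fin 3))) R, ∀ b i j, ‖Ũ z b i j‖ ≤ 𝓐₀) ∧
        ∀ p B' : VecField P k E3, ‖p‖ < R → ‖B'‖ < R → ∃ U' : GaugeField P 0 SU2,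
          (∀ b, Ũ (cplxVec p, cplxVec B') b = ((U' b : SU2) : Matrix (Fin 2) (Fin 2) ℂ)) ∧
            IsMinimizer (fun j => blockAvg (P := P) (j := j) expMeanLogSU) reg 𝔹
              (avgFamily (fun j => blockAvg (P := P) (j := j) expMeanLogSU) (qsstarGIter0 k (expMul su2Chart B' (ext (expMul su2Chart p Vk))))) U' := by
  refine hMin_of_localCharts Λ lo hi (fun j => blockAvg (P := P) (j := j) expMeanLogSU) reg 𝔹 ext hK fun Vk hVk => ?_
  obtain ⟨U₀, S, a, Φ₀, ℓ₀, hsbQ, hsbU, hU₀, hS, ha, hΦ₀, hcrit, honto, hnondeg, hclass, hcritT⟩ := hbase Vk hVk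
  obtain ⟨O, hO, hmem, Γ, hΓd, hΓb, hΓr⟩ := exists_localChart_at_baseField 𝔹 k h𝔹 reg hsbQ hsbU hU₀ S hS a ha Φ₀ hΦ₀ hcrit honto hnondeg
    Crit hclass hcritT (hT1u Vk hVk) h𝓐₀
  refine ⟨O, hO, by rwa [datumC_coeField_zero Λ lo hi ext hext], Γ, hΓd, hΓb, fun p B' Vk' hQ' => ?_⟩
  have hreal : datumC Λ lo hi (coeField Vk') (cplxVec p) (cplxVec B') =
      coeField (qsstarGIter0 k (expMul su2Chart B' (ext (expMul su2Chart p Vk')))) := by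
    rw [datumC_real, ← hext]
  rw [hreal] at hQ' ⊢
  exact hΓr _ hQ'

end Literature.MathematicalPhysics.QuantumFieldTheory.Balaban1983to89.B15Prop1MinimiserFamilyAtRecord

end
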